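import Mathlib
import HarnessLib
import Summits.AtomisticToContinuum.Crystallization.Theorems.FrustratedLawDichotomyTwoShellRigidityLsFitReplayRat
import Summits.AtomisticToContinuum.Crystallization.Theorems.FrustratedLawDichotomyTwoShellRigidityLsFitCellsHcp

/-!
# Two-shell rigidity, slot 3 · ★ `SphericalLsFit (7/200) (1/100) hcpKissingPattern probes26 (221 / 2500) (83 / 2500) (21 / 500) (27 / 400)`

The braced ω-sub-leaf B-run of record (hcp; decomp-a2c census-1 g22): `checkAllF hcpModel prmHcp hcpCellsF = true` assembled from
the per-shard replays (hcp_runCellF_01, hcp_runCellF_04, hcp_runCellF_08, hcp_runCellF_12, hcp_runCellF_15, hcp_runCellF_16) and the chart coverage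
(`native_decide`), then the rational interface `sphericalLsFit_hcp_of_checkAllF'` of `…TwoShellRigidityLsFitReplayRat` (lens-3 g37) at
the dial (α, Ω, V₁, V₃) = (221 / 2500, 83 / 2500, 21 / 500, 27 / 400) dominating the certified readings
(0.08817, 0.03314, 0.04194, 0.06745).  Consumer: `…lsEntryAt_hcp_of_sphericalLsFit(_braced)`.
-/

namespace Summit.AtomisticToContinuum.Crystallization.Theorems

namespace Rig

open Summit.AtomisticToContinuum.Crystallization.Theorems.FrustratedLawDichotomyTwoShellRigidityLsLedger
open Summit.AtomisticToContinuum.Crystallization.Theorems.FrustratedLawDichotomyTwoShellRigidityGaugedLadder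
open Literature.Geometry.DiscreteGeometry

/-- Both charts of the hcp fit run are covered. -/
theorem hcp_coversF :
    (coversChart (hcpCellsF.map CellF.skel) true && coversChart (hcpCellsF.map CellF.skel) false) = true := by
  native_decide

/-- ★ The hcp fit run of record passes `checkAllF`. -/
theorem hcp_checkAllF : checkAllF hcpModel prmHcp hcpCellsF = true := by
  have hc := hcp_coversF
  simp only [hcpCellsF, List.map_append] at hc
  simp only [checkAllF, hcpCellsF, List.map_append, List.all_append, hc, hcp_runCellF_01, hcp_runCellF_04, hcp_runCellF_08, hcp_runCellF_12, hcp_runCellF_15, hcp_runCellF_16,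
    Bool.and_self]

/-- ★ **`SphericalLsFit (7/200) (1/100) hcpKissingPattern probes26 α Ω V₁ V₃`** at the dial of the B-run of record. -/
theorem sphericalLsFit_hcp :
    SphericalLsFit (7 / 200) (1 / 100) hcpKissingPattern probes26 (221 / 2500) (83 / 2500) (21 / 500) (27 / 400) :=
  sphericalLsFit_hcp_of_checkAllF' hcp_checkAllF rfl (by norm_num [SC, prmHcp]) (by norm_num) (by norm_num) (by norm_num) (by norm_num)
    (by norm_num) (by norm_num [SC, prmHcp]) (by norm_num [SC, prmHcp]) (by norm_num [SC, prmHcp]) (by norm_num [SC, prmHcp]) (by norm_num [SC, prmHcp])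
    (by norm_num [SC, prmHcp]) (by norm_num [SC, prmHcp]) (by norm_num [SC, prmHcp])

end Rig

end Summit.AtomisticToContinuum.Crystallization.Theorems
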